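import Summits.QuantumFields.YangMills.Theorems.BalabanUVNodesN08HaarCompatibilityGuardCoreLawSU2
import Summits.QuantumFields.YangMills.Theorems.BalabanUVNodesN08HaarCompatibilityGuardCoreChartTarget

/-!
# BalabanUVNodes ∕ N08 — (H_K-core) AT `N = 2` WITH THE TARGET CHART CENTRED AT `Φ_V(w₀)`: the range becomes part 26B's injectivity smallness ALONE,
# `#non-central∕|Idx| ≤ 24∕25`, i.e. `L^{d−1} ≤ 25` (block sizes `L ∈ {3, 5}` at `d = 3`); (H_K) at `N = 2` and part 20's one-step bound there, no (H_K) hypothesis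

WIDTH SEAT `pub-ymgap-dag-n08-w3` g5, `W-SEAT-START-LIST.md` §0 (iii); item-3 lineage part 29C = part 27C (`…GuardCoreLawSU2`, range `L^{d−1} ≤ 9`) re-run with the target
chart centred at `Φ_V(w₀)` (parts 29A `…TangentDictionary`, 29B `…CoreChartTarget`): the domain restriction `‖Y‖ + 2δ < 1` of 27B disappears (n08-w6's hs-contraction
p620432 integrated along guarded geodesics gives `‖z̄k(w) − 1‖ ≤ ‖A‖ < 7∕10` for EVERY `Σcᵢ ≤ 1`) and the range is part 26B's smallness `(Σcᵢ)θ² < sin²θ` at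
`θ = 17∕50`: `Σcᵢ ≤ 24∕25` — 2026-08-28.  DAG node N08 = [Balaban1985UV3] Thm 1 p. 257 + Thm 2 p. 272; [Balaban1987RG1] (0.4) p. 253; key item K1⁷
`StabilityBAtRecordR13SepCoPH` (stmt-QuantumFields-20542, `aside`), `--supports … --as helper`.  COUNT-NEUTRAL.

WHAT THIS FILE PROVES (theorems only, 0 def; bookkeeping over parts 24–29B, n08-w6 p624108 and part 11 BY IMPORT; the proofs are part 27C's with three edits):
 §2 ★★★ `core_law_le_su2_wide`: (H_K-core) at `N = 2` for `s = #nc∕|Idx| ≤ 24∕25`: `Haar∘Φ_V⁻¹ ≤ (m⁻¹ + 1)•Haar`, `m = κ₀³q²`, `κ₀ = (1 − s)·sin 1·q`, `q = sin(π∕3)∕(π∕3)`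
    (part 25's frame with `w₁ := Φ_V(w₀)`).
 §3 `mstar_wide_pos` · ★★ `core_law_le_su2_wide_unif` (constant at `s = 24∕25`: `m⋆⋆ = ((1∕25) sin 1 q)³q²`, `K ≈ 6.8·10⁴`) · ★★ `fibre_law_le_su2_wide` ((H_K) at `N = 2`) ·
    `smul_map_avOfPrint_le_su2_wide`.
 §4 `card_not_central_div_le_wide` · ★★★ `smul_map_avOfPrint_le_su2_wide_of_pow_le`: **part 20's one-step extensive transport bound at `avOfPrint 2 S₀ j` WITH (H_K) DISCHARGED
    on `S₀.P.L^{d−1} ≤ 25`** (block sizes `L ∈ {3, 5}` at `d = 3`).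
HONEST FRAMING: the record's `8 ≤ θ.L` ([B13] closers, `CarriersB13.eight_le_c13OfRecord_L_iff`) is STILL NOT covered — for `L ≥ 7` at `N = 2` the tree offers only an
existential sheet count (n08-w6 g5's `…GuardIntrinsicJacobian` lane) or the conjectured sharp `(1 − Σcᵢ)`-expansion (`N08-EML-GRADIENT-STEP.md`, NOT a claim); ONE RG step;
`hmass` (k-uniform) NOT supplied; E6′ NOT decided; count-neutral; N08 NOT discharged; counts unmoved (typed 28∕28 · discharged 5∕27); R4 closes the CONDITIONAL rung
`BalabanLadder.UV` only; the Yang–Mills mass gap (Clay) is NOT proved; nothing continuum ∕ OS.  0 `sorry`, standard axioms.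
-/

noncomputable section

open NormedSpace Set Metric Function Filter MeasureTheory
open scoped RealInnerProductSpace Topology Quaternion ENNReal

namespace Summit.QuantumFields.YangMills.BalabanUVNodes.N08HaarCompatibilityGuardCoreLawSU2Wide

open Literature.MathematicalPhysics.QuantumFieldTheory (haarProbability)
open Literature.MathematicalPhysics.QuantumFieldTheory.Balaban1983to89
open Literature.MathematicalPhysics.QuantumFieldTheory.Balaban1983to89.T4QuatExpLog
open Literature.MathematicalPhysics.QuantumFieldTheory.Balaban1983to89.T4EMLFibreAC
open Literature.MathematicalPhysics.QuantumFieldTheory.Balaban1983to89.T4EMLTangentInjective (Kmat)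
open Literature.MathematicalPhysics.QuantumFieldTheory.Balaban1983to89.T4HaarSU2ExpChart (imQuat imQuat_re norm_imQuat expPoint
  su2Quat_expPoint injOn_expPoint)
open Literature.MathematicalPhysics.QuantumFieldTheory.Balaban1983to89.T4ExpWindowSmallField (imVec dist1_eq_norm_su2Quat_sub_one)
open Literature.MathematicalPhysics.QuantumFieldTheory.Balaban1983to89.B10Eq18SigmaSU2Haar (rev rev_rev norm_rev expPauli expPauli_eq_expPoint)
open Literature.MathematicalPhysics.QuantumFieldTheory.Balaban1983to89.B10Eq22Rescaling (sigmaSU2)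
open Literature.MathematicalPhysics.QuantumFieldTheory.Balaban1983to89.ExpMeanLog (expMeanLogSU expMeanLogSU_δ deltaSU lt_third_of_lt_deltaSU
  measurable_expMeanLogSU_E)
open Literature.MathematicalPhysics.QuantumFieldTheory.Balaban1983to89.BlockAveraging (Idx)
open Literature.MathematicalPhysics.QuantumFieldTheory.Balaban1983to89.BlockAveraging (Small avgFun)
open Literature.MathematicalPhysics.QuantumFieldTheory.Balaban1983to89.BlockAveragingHaarAC (IsCentral centralBond nCentral)
open Summit.QuantumFields.YangMills.BalabanUVNodes.N08HaarCompatibilityGuardPowerMap (nCentral_mul_pow nCentral_div_card_real)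
open Literature.MathematicalPhysics.QuantumFieldTheory.Balaban1985CMP102.Setting (Scales)
open Literature.MathematicalPhysics.QuantumFieldTheory.Balaban1983to89.B10RunsOfRecord (avOfPrint)
open Summit.QuantumFields.YangMills.BalabanUVNodes.N08HaarCompatibilityGuardFibreCore (fibre_law_le_of_core smul_map_avOfPrint_le_of_core)
open Literature.MathematicalPhysics.QuantumLattice (quatMatrix su2Quat norm_su2Quat quatToSU2 quatToSU2_su2Quat quatMatrix_su2Quat)
open Literature.MathematicalPhysics.QuantumFieldTheory.Balaban1983to89.T4HaarSU2Translate (su2Quat_mul haarData_haar_eq)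
open Summit.QuantumFields.YangMills.BalabanUVNodes.N08HaarCompatibilityGuardGeodesics
open Summit.QuantumFields.YangMills.BalabanUVNodes.N08HaarCompatibilityGuardCoreInjective
open Summit.QuantumFields.YangMills.BalabanUVNodes.N08HaarCompatibilityGuardChartLift
open Summit.QuantumFields.YangMills.BalabanUVNodes.N08HaarCompatibilityGuardCoreChart
open Summit.QuantumFields.YangMills.BalabanUVNodes.N08HaarCompatibilityGuardCoreChartTarget
open Summit.QuantumFields.YangMills.BalabanUVNodes.N08HaarCompatibilityGuardCoreLawSU2 (delta_two kf_eq_su2Quat_core quat_guard norm_su2Quat_sub_lt)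
open Summit.QuantumFields.YangMills.BalabanUVNodes.N08HaarCompatibilityGuardOneWindow (coreGuard_subset_ball core_law_le_of_one_window)
open Summit.QuantumFields.YangMills.BalabanUVNodes.N08HaarCompatibilityGuardCoerciveWindows (haarJacobianFloor_of_det_floor)
open Summit.QuantumFields.YangMills.BalabanUVNodes.N08HaarCompatibilityGuardCoreKmatDictionary (core_eq_kmat guard_of_core)


variable {P : Params} {j : ℕ}

/-! ## §2 (H_K-core) at `N = 2` -/

/-- ★★★ **(H_K-core) AT `N = 2`, WIDE RANGE.**  For the printed average on `SU(2)`, every coarse bond `c`, every frozen family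
`V : Idx → SU(2)` whose core family meets the guard, with `s := #non-central∕|Idx| ≤ 24∕25`:
**`Haar ∘ Φ_V⁻¹ ≤ (m⁻¹ + 1)•Haar`,  `m = κ₀³·(sin(π∕3)∕(π∕3))²`,  `κ₀ = (1 − s)·sin 1·(sin(π∕3)∕(π∕3))`** — part 25's one-window frame with the chart
conjugate of part 29B (`w₁ := Φ_V(w₀)`; derivative floor ⇒ determinant floor by part 27A's volume lemma ⇒ Haar-Jacobian floor by part 22; injectivity from
part 26B `injOn_expMeanLog` at `θ = 17∕50` + `injOn_expPoint`; the all-central case is the identity map).  Count-neutral; the constant is NOT optimised.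
[cite: Balaban1987RG1, (0.4) p.253; Balaban1985UV3, p.260 (bookkeeping — the bound is NOT in print)] -/
theorem core_law_le_su2_wide (c : PBond P (j + 1)) (V : Idx P → (Matrix.specialUnitaryGroup (Fin 2) ℂ))
    (hex : ∃ w₀ : (Matrix.specialUnitaryGroup (Fin 2) ℂ), ∀ i : Idx P, dist1 (if IsCentral c i then (1 : (Matrix.specialUnitaryGroup (Fin 2) ℂ)) else V i * w₀⁻¹) < (expMeanLogSU : LoopAverage (Matrix.specialUnitaryGroup (Fin 2) ℂ)).δ)
    (hs : (Fintype.card {i : Idx P // ¬ IsCentral c i} : ℝ) * ((Fintype.card (Idx P) : ℝ))⁻¹ ≤ 24 / 25) :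
    (haarProbability (Matrix.specialUnitaryGroup (Fin 2) ℂ)).map (fun w : (Matrix.specialUnitaryGroup (Fin 2) ℂ) =>
      (if ∀ i : Idx P, dist1 (if IsCentral c i then (1 : (Matrix.specialUnitaryGroup (Fin 2) ℂ)) else V i * w⁻¹) < (expMeanLogSU : LoopAverage (Matrix.specialUnitaryGroup (Fin 2) ℂ)).δ then
          (expMeanLogSU : LoopAverage (Matrix.specialUnitaryGroup (Fin 2) ℂ)).avg (fun i : Idx P => if IsCentral c i then (1 : (Matrix.specialUnitaryGroup (Fin 2) ℂ)) else V i * w⁻¹) else 1) * w) ≤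
      ((ENNReal.ofReal (((1 - (Fintype.card {i : Idx P // ¬ IsCentral c i} : ℝ) * ((Fintype.card (Idx P) : ℝ))⁻¹) * Real.sin 1 *
          (Real.sin (Real.pi / 3) / (Real.pi / 3))) ^ 3 * (Real.sin (Real.pi / 3) / (Real.pi / 3)) ^ 2))⁻¹ + 1) •
        haarProbability (Matrix.specialUnitaryGroup (Fin 2) ℂ) := by
  obtain ⟨w₀, hw₀⟩ := hex
  set s : ℝ := (Fintype.card {i : Idx P // ¬ IsCentral c i} : ℝ) * ((Fintype.card (Idx P) : ℝ))⁻¹ with hs_def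
  set q3 : ℝ := Real.sin (Real.pi / 3) / (Real.pi / 3) with hq3_def
  set κ₀ : ℝ := (1 - s) * Real.sin 1 * q3 with hκ₀_def
  have hπ3 : Real.pi / 3 ≤ Real.pi := by linarith [Real.pi_gt_three]
  have hq3pos : 0 < q3 := div_pos (Real.sin_pos_of_pos_of_lt_pi (by positivity) (by linarith [Real.pi_gt_three])) (by positivity)
  have hsin1 : 0 < Real.sin 1 := Real.sin_pos_of_pos_of_lt_pi one_pos (by linarith [Real.pi_gt_three])
  have h1s : 0 < 1 - s := by linarith
  have hκ₀ : 0 < κ₀ := by positivity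
  set m : ℝ≥0∞ := ENNReal.ofReal (κ₀ ^ 3 * q3 ^ 2) with hm_def
  have hm0 : m ≠ 0 := (ENNReal.ofReal_pos.2 (by positivity)).ne'
  have hmt : m ≠ ∞ := ENNReal.ofReal_ne_top
  -- the all-central case: the core map is the identity
  by_cases hall : ∀ i : Idx P, IsCentral c i
  · have hcore : (fun w : (Matrix.specialUnitaryGroup (Fin 2) ℂ) => (if ∀ i : Idx P, dist1 (if IsCentral c i then (1 : (Matrix.specialUnitaryGroup (Fin 2) ℂ)) else V i * w⁻¹) < (expMeanLogSU : LoopAverage (Matrix.specialUnitaryGroup (Fin 2) ℂ)).δ then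
          (expMeanLogSU : LoopAverage (Matrix.specialUnitaryGroup (Fin 2) ℂ)).avg (fun i : Idx P => if IsCentral c i then (1 : (Matrix.specialUnitaryGroup (Fin 2) ℂ)) else V i * w⁻¹) else 1) * w) = id := by
      funext w
      have hg : ∀ i : Idx P, dist1 (if IsCentral c i then (1 : (Matrix.specialUnitaryGroup (Fin 2) ℂ)) else V i * w⁻¹) < (expMeanLogSU : LoopAverage (Matrix.specialUnitaryGroup (Fin 2) ℂ)).δ := fun i => by
        rw [if_pos (hall i), GaugeGroup.dist1_one, delta_two]; norm_num
      rw [if_pos hg, id]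
      apply Subtype.ext
      rw [core_eq_kmat c V w hg, Kmat]
      haveI : IsEmpty {i : Idx P // ¬ IsCentral c i} := ⟨fun i => i.2 (hall i)⟩
      simp [NormedSpace.exp_zero]
    rw [hcore, Measure.map_id]
    refine Measure.le_iff'.2 fun t => ?_
    rw [Measure.smul_apply, smul_eq_mul]
    exact le_mul_of_one_le_left (by simp) le_add_self
  obtain ⟨i₀, hi₀⟩ := not_forall.1 hall
  -- letters of the quaternion model
  set a : {i : Idx P // ¬ IsCentral c i} → ℍ := fun i => su2Quat (V i) with ha_def
  set cw : {i : Idx P // ¬ IsCentral c i} → ℝ := fun _ => ((Fintype.card (Idx P) : ℝ))⁻¹ with hcw_def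
  have ha : ∀ i, ‖a i‖ = 1 := fun i => norm_su2Quat (V i)
  have hc : ∀ i, 0 ≤ cw i := fun _ => inv_nonneg.2 (Nat.cast_nonneg _)
  have hcs : ∑ i, cw i = s := by rw [hcw_def, Finset.sum_const, Finset.card_univ, nsmul_eq_mul]
  have hs8 : ∑ i, cw i ≤ 24 / 25 := hcs ▸ hs
  have hs1 : ∑ i, cw i ≤ 1 := hs8.trans (by norm_num)
  set u₀ : ℍ := su2Quat w₀ with hu₀_def
  have hu₀ : ‖u₀‖ = 1 := norm_su2Quat w₀
  set S : Set (Matrix.specialUnitaryGroup (Fin 2) ℂ) := {w : (Matrix.specialUnitaryGroup (Fin 2) ℂ) | ∀ i : Idx P, dist1 (if IsCentral c i then (1 : (Matrix.specialUnitaryGroup (Fin 2) ℂ)) else V i * w⁻¹) < (expMeanLogSU : LoopAverage (Matrix.specialUnitaryGroup (Fin 2) ℂ)).δ} with hS_def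
  -- measurability
  have hΦ := N08HaarCompatibilityGuardFibreCore.measurable_core (expMeanLogSU : LoopAverage (Matrix.specialUnitaryGroup (Fin 2) ℂ)) measurable_expMeanLogSU_E c V
  have hSm : MeasurableSet S := by
    have hF : Measurable fun w : (Matrix.specialUnitaryGroup (Fin 2) ℂ) => fun i : Idx P => if IsCentral c i then (1 : (Matrix.specialUnitaryGroup (Fin 2) ℂ)) else V i * w⁻¹ := by
      refine measurable_pi_lambda _ fun i => ?_
      by_cases h : IsCentral c i
      · simp only [if_pos h]; exact measurable_const
      · simp only [if_neg h]; exact (measurable_const_mul (V i)).comp measurable_inv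
    have : S = ⋂ i : Idx P, {w : (Matrix.specialUnitaryGroup (Fin 2) ℂ) | dist1 (if IsCentral c i then (1 : (Matrix.specialUnitaryGroup (Fin 2) ℂ)) else V i * w⁻¹) < (expMeanLogSU : LoopAverage (Matrix.specialUnitaryGroup (Fin 2) ℂ)).δ} := by ext w; simp [hS_def]
    rw [this]
    exact MeasurableSet.iInter fun i =>
      measurableSet_lt (RegularGaugeGroup.measurable_dist1.comp ((measurable_pi_apply i).comp hF)) measurable_const
  -- the window and the chart conjugate
  have hr : Real.pi * (expMeanLogSU : LoopAverage (Matrix.specialUnitaryGroup (Fin 2) ℂ)).δ ≤ Real.pi / 3 := by rw [delta_two]; linarith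
  -- the target chart is centred at `w₁ := Φ_V(w₀)`, `z := su2Quat w₁ = k(u₀)`
  set w₁ : (Matrix.specialUnitaryGroup (Fin 2) ℂ) := (expMeanLogSU : LoopAverage (Matrix.specialUnitaryGroup (Fin 2) ℂ)).avg
      (fun i : Idx P => if IsCentral c i then (1 : (Matrix.specialUnitaryGroup (Fin 2) ℂ)) else V i * w₀⁻¹) * w₀ with hw₁_def
  set z : ℍ := su2Quat w₁ with hz_def
  have hz : ‖z‖ = 1 := norm_su2Quat w₁
  have hzk : kf a cw u₀ = z := by rw [hz_def, hw₁_def, hu₀_def]; exact kf_eq_su2Quat_core c V hw₀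
  set ψ : EuclideanSpace ℝ (Fin 3) → EuclideanSpace ℝ (Fin 3) :=
    fun A => rev (imVec (qlog (star z * kf a cw (u₀ * exp (imQuat (rev A)))))) with hψ_def
  set W : Set (EuclideanSpace ℝ (Fin 3)) := ball (0 : EuclideanSpace ℝ (Fin 3)) (Real.pi / 3) ∩ {A | w₀ * expPauli A ∈ S} with hW_def
  have hquat : ∀ A : EuclideanSpace ℝ (Fin 3), su2Quat (w₀ * expPauli A) = u₀ * exp (imQuat (rev A)) := fun A => by
    rw [su2Quat_mul, expPauli_eq_expPoint, su2Quat_expPoint]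
  have hWS : ∀ A ∈ W, (w₀ * expPauli A) ∈ S := fun A hA => hA.2
  have hWπ : ∀ A ∈ W, ‖A‖ < Real.pi / 3 := fun A hA => mem_ball_zero_iff.1 hA.1
  have hWg : ∀ A ∈ W, ∀ i, ‖a i * star (u₀ * exp (imQuat (rev A))) - 1‖ < 1 / 3 := fun A hA i => by
    rw [← hquat]; exact quat_guard c V (hWS A hA) i
  have hWd : ∀ A ∈ W, ‖u₀ * exp (imQuat (rev A)) - u₀‖ < 2 / 3 := fun A hA => by
    rw [← hquat, hu₀_def]; exact norm_su2Quat_sub_lt c V hi₀ hw₀ (hWS A hA)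
  have hW1 : ∀ A ∈ W, ‖u₀ * exp (imQuat (rev A))‖ = 1 := fun A hA => by rw [← hquat]; exact norm_su2Quat _
  have hWg2 : ∀ A ∈ W, ∀ i, ‖a i * star (u₀ * exp (imQuat (rev A))) - 1‖ < 1 / 2 := fun A hA i => (hWg A hA i).trans (by norm_num)
  have hg0 : ∀ i, ‖a i - u₀‖ < 1 / 3 := fun i => by rw [← norm_mul_star_sub_one hu₀, hu₀_def]; exact quat_guard c V hw₀ i
  have hg1 : ∀ A ∈ W, ∀ i, ‖a i - u₀ * exp (imQuat (rev A))‖ < 1 / 3 := fun A hA i => by rw [← norm_mul_star_sub_one (hW1 A hA)]; exact hWg A hA i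
  -- the log-ball condition at the centre `z = k(u₀)`, by part 29A's 1-Lipschitz bound
  have hv : ∀ A ∈ W, ‖star z * kf a cw (u₀ * exp (imQuat (rev A)))‖ = 1 ∧ ‖star z * kf a cw (u₀ * exp (imQuat (rev A))) - 1‖ < 1 := by
    intro A hA
    obtain ⟨h1, h2⟩ := norm_target_kf_sub_one_le cw hu₀ ha hc hs1 (by norm_num : (1 / 3 : ℝ) ≤ 1 / 2) (hWπ A hA) hg0 (hg1 A hA)
    rw [hzk] at h1 h2
    exact ⟨h1, h2.trans_lt ((norm_lt_of_chord hu₀ (hWπ A hA) (hWd A hA)).trans (by norm_num))⟩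
  have key : ∀ A ∈ W, ∃ D : EuclideanSpace ℝ (Fin 3) →L[ℝ] EuclideanSpace ℝ (Fin 3), HasFDerivAt ψ D A ∧ ∀ h, κ₀ * ‖h‖ ≤ ‖D h‖ := by
    intro A hA
    obtain ⟨D, hD, hfl⟩ := exists_hasFDerivAt_chart_of_target cw hu₀ hz ha hc hs1 (hWπ A hA) (hWg2 A hA) (hv A hA).2
    refine ⟨D, hD, fun h => ?_⟩
    have := hfl h
    rwa [hcs] at this
  choose! D hD hfloor using key
  -- the conjugacy and the range
  have hconjq : ∀ A ∈ W, z * exp (imQuat (rev (ψ A))) = kf a cw (u₀ * exp (imQuat (rev A))) ∧ ‖ψ A‖ < Real.pi / 3 := fun A hA =>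
    chart_conj_of_target cw hz (hv A hA).1 (hv A hA).2
  have hsu2inj : Function.Injective (su2Quat : (Matrix.specialUnitaryGroup (Fin 2) ℂ) → ℍ) := Function.LeftInverse.injective quatToSU2_su2Quat
  have hconj : ∀ A ∈ W,
      (if ∀ i : Idx P, dist1 (if IsCentral c i then (1 : (Matrix.specialUnitaryGroup (Fin 2) ℂ)) else V i * (w₀ * expPauli A)⁻¹) < (expMeanLogSU : LoopAverage (Matrix.specialUnitaryGroup (Fin 2) ℂ)).δ then
          (expMeanLogSU : LoopAverage (Matrix.specialUnitaryGroup (Fin 2) ℂ)).avg (fun i : Idx P => if IsCentral c i then (1 : (Matrix.specialUnitaryGroup (Fin 2) ℂ)) else V i * (w₀ * expPauli A)⁻¹) else 1) *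
        (w₀ * expPauli A) = w₁ * expPauli (ψ A) := by
    intro A hA
    have hg : ∀ i : Idx P, dist1 (if IsCentral c i then (1 : (Matrix.specialUnitaryGroup (Fin 2) ℂ)) else V i * (w₀ * expPauli A)⁻¹) < (expMeanLogSU : LoopAverage (Matrix.specialUnitaryGroup (Fin 2) ℂ)).δ := hWS A hA
    rw [if_pos hg]
    apply hsu2inj
    rw [← kf_eq_su2Quat_core c V (hWS A hA), hquat, su2Quat_mul, expPauli_eq_expPoint, su2Quat_expPoint, ← hz_def, (hconjq A hA).1]
  have hmaps : MapsTo ψ W (ball (0 : EuclideanSpace ℝ (Fin 3)) Real.pi) := fun A hA =>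
    mem_ball_zero_iff.2 ((hconjq A hA).2.trans_le hπ3)
  -- injectivity: part 26B on the guard set + injectivity of the exponential chart
  have hK : InjOn (fun w : (Matrix.specialUnitaryGroup (Fin 2) ℂ) => (if ∀ i : Idx P, dist1 (if IsCentral c i then (1 : (Matrix.specialUnitaryGroup (Fin 2) ℂ)) else V i * w⁻¹) < (expMeanLogSU : LoopAverage (Matrix.specialUnitaryGroup (Fin 2) ℂ)).δ then
          (expMeanLogSU : LoopAverage (Matrix.specialUnitaryGroup (Fin 2) ℂ)).avg (fun i : Idx P => if IsCentral c i then (1 : (Matrix.specialUnitaryGroup (Fin 2) ℂ)) else V i * w⁻¹) else 1) * w) S := by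
    have hsin : (1 / 3 : ℝ) ≤ Real.sin (17 / 50) := by
      have := Real.sin_gt_sub_cube (show (0:ℝ) < 17/50 by norm_num); nlinarith
    have hsm : (∑ i, cw i) * (17 / 50 : ℝ) ^ 2 < Real.sin (17 / 50) ^ 2 := by
      have h3 : (0 : ℝ) < 17 / 50 - (17 / 50) ^ 3 / 6 := by norm_num
      have h4 : ((17 / 50 : ℝ) - (17 / 50) ^ 3 / 6) ^ 2 < Real.sin (17 / 50) ^ 2 :=
        pow_lt_pow_left₀ (Real.sin_gt_sub_cube (show (0:ℝ) < 17/50 by norm_num)) h3.le two_ne_zero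
      nlinarith
    refine injOn_expMeanLog (S := S) (fun i : {i : Idx P // ¬ IsCentral c i} => V i) hc (by norm_num) (by norm_num) hsin hsm
      (fun w hw i => lt_third_of_lt_deltaSU (guard_of_core c V w hw i)) (fun w hw => ?_)
    have hg : ∀ i : Idx P, dist1 (if IsCentral c i then (1 : (Matrix.specialUnitaryGroup (Fin 2) ℂ)) else V i * w⁻¹) < (expMeanLogSU : LoopAverage (Matrix.specialUnitaryGroup (Fin 2) ℂ)).δ := hw
    rw [if_pos hg, core_eq_kmat c V w hg, Kmat]
  have hinj : InjOn ψ W := by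
    intro A₁ hA₁ A₂ hA₂ heq
    have h1 := hconj A₁ hA₁
    have h2 := hconj A₂ hA₂
    rw [heq] at h1
    have h12 : w₀ * expPauli A₁ = w₀ * expPauli A₂ := hK (hWS A₁ hA₁) (hWS A₂ hA₂) (h1.trans h2.symm)
    have h3 : expPoint (rev A₁) = expPoint (rev A₂) := by
      rw [← expPauli_eq_expPoint, ← expPauli_eq_expPoint]; exact mul_left_cancel h12
    have h4 : rev A₁ = rev A₂ :=
      injOn_expPoint (mem_ball_zero_iff.2 (by rw [norm_rev]; exact (hWπ A₁ hA₁).trans_le hπ3))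
        (mem_ball_zero_iff.2 (by rw [norm_rev]; exact (hWπ A₂ hA₂).trans_le hπ3)) h3
    simpa using congrArg rev h4
  -- the Haar-Jacobian floor through the determinant floor
  have hdet : ∀ A ∈ W, κ₀ ^ 3 ≤ |(D A).det| := fun A hA => by
    have h := pow_le_abs_det_of_norm_le (D A) hκ₀ (hfloor A hA)
    rwa [Fintype.card_fin] at h
  have hm := haarJacobianFloor_of_det_floor (W := W) (ψc := ψ) (ψc' := D) (r₀ := Real.pi / 3) (m₀ := κ₀ ^ 3) (by positivity) hπ3
    (by positivity) (fun A hA => (hconjq A hA).2.le) hdet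
  -- assemble with part 25
  exact core_law_le_of_one_window (expMeanLogSU : LoopAverage (Matrix.specialUnitaryGroup (Fin 2) ℂ)) c V hi₀ hw₀ hΦ hSm hr hπ3 w₁ hconj hmaps (fun A hA => (hD A hA).hasFDerivWithinAt) hinj hm0 hmt hm

/-! ## §3 A constant uniform in the coarse bond; (H_K) and part 20's one-step bound at the slot WITHOUT the (H_K) hypothesis -/

/-- The uniform constant is positive: `0 < ((1∕25)·sin 1·q)³·q²`, `q = sin(π∕3)∕(π∕3)`. [folklore] -/
theorem mstar_wide_pos : 0 < ((1 / 25 : ℝ) * Real.sin 1 * (Real.sin (Real.pi / 3) / (Real.pi / 3))) ^ 3 * (Real.sin (Real.pi / 3) / (Real.pi / 3)) ^ 2 := by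
  have hsin1 : 0 < Real.sin 1 := Real.sin_pos_of_pos_of_lt_pi one_pos (by linarith [Real.pi_gt_three])
  have hq : 0 < Real.sin (Real.pi / 3) / (Real.pi / 3) :=
    div_pos (Real.sin_pos_of_pos_of_lt_pi (by positivity) (by linarith [Real.pi_gt_three])) (by positivity)
  positivity

/-- ★★ **(H_K-core) WITH ONE CONSTANT, WIDE RANGE**: on `#non-central∕|Idx| ≤ 24∕25` the law of the core map is `≤ (m⋆⋆⁻¹ + 1)•Haar` with
`m⋆⋆ = ((1∕25)·sin 1·q)³·q²` — the value of `core_law_le_su2_wide`'s constant at `s = 24∕25` (monotonicity in `s`). [folklore] -/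
theorem core_law_le_su2_wide_unif (c : PBond P (j + 1)) (V : Idx P → (Matrix.specialUnitaryGroup (Fin 2) ℂ))
    (hex : ∃ w₀ : (Matrix.specialUnitaryGroup (Fin 2) ℂ), ∀ i : Idx P, dist1 (if IsCentral c i then (1 : (Matrix.specialUnitaryGroup (Fin 2) ℂ)) else V i * w₀⁻¹) < (expMeanLogSU : LoopAverage (Matrix.specialUnitaryGroup (Fin 2) ℂ)).δ)
    (hs : (Fintype.card {i : Idx P // ¬ IsCentral c i} : ℝ) * ((Fintype.card (Idx P) : ℝ))⁻¹ ≤ 24 / 25) :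
    (haarProbability (Matrix.specialUnitaryGroup (Fin 2) ℂ)).map (fun w : (Matrix.specialUnitaryGroup (Fin 2) ℂ) =>
      (if ∀ i : Idx P, dist1 (if IsCentral c i then (1 : (Matrix.specialUnitaryGroup (Fin 2) ℂ)) else V i * w⁻¹) < (expMeanLogSU : LoopAverage (Matrix.specialUnitaryGroup (Fin 2) ℂ)).δ then
          (expMeanLogSU : LoopAverage (Matrix.specialUnitaryGroup (Fin 2) ℂ)).avg (fun i : Idx P => if IsCentral c i then (1 : (Matrix.specialUnitaryGroup (Fin 2) ℂ)) else V i * w⁻¹) else 1) * w) ≤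
      ((ENNReal.ofReal (((1 / 25 : ℝ) * Real.sin 1 * (Real.sin (Real.pi / 3) / (Real.pi / 3))) ^ 3 * (Real.sin (Real.pi / 3) / (Real.pi / 3)) ^ 2))⁻¹ + 1) •
        haarProbability (Matrix.specialUnitaryGroup (Fin 2) ℂ) := by
  refine (core_law_le_su2_wide c V hex hs).trans (Measure.le_iff'.2 fun t => ?_)
  rw [Measure.smul_apply, Measure.smul_apply, smul_eq_mul, smul_eq_mul]
  refine mul_le_mul' (add_le_add (ENNReal.inv_le_inv.2 (ENNReal.ofReal_le_ofReal ?_)) le_rfl) le_rfl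
  have hq : 0 ≤ Real.sin (Real.pi / 3) / (Real.pi / 3) :=
    div_nonneg (Real.sin_nonneg_of_nonneg_of_le_pi (by positivity) (by linarith [Real.pi_gt_three])) (by positivity)
  have hsin1 : 0 ≤ Real.sin 1 := Real.sin_nonneg_of_nonneg_of_le_pi zero_le_one (by linarith [Real.pi_gt_three])
  have h19 : (1 / 25 : ℝ) ≤ 1 - (Fintype.card {i : Idx P // ¬ IsCentral c i} : ℝ) * ((Fintype.card (Idx P) : ℝ))⁻¹ := by linarith
  gcongr

/-- ★★ **(H_K) AT `N = 2` WITHOUT HYPOTHESIS, WIDE RANGE** (`∀ c, #non-central(c)∕|Idx| ≤ 24∕25`): every guard-admitting one-variable fibre law of the typed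
(0.4) averaging with the printed `SU(2)` average is `≤ (m⋆⋆⁻¹ + 1)•Haar` — part 24's `fibre_law_le_of_core` fed with `core_law_le_su2_wide_unif`.
[cite: Balaban1987RG1, (0.4) p.253 (bookkeeping — the bound is NOT in print)] -/
theorem fibre_law_le_su2_wide (hj : j + 1 ≤ P.m + P.K)
    (hs : ∀ c : PBond P (j + 1), (Fintype.card {i : Idx P // ¬ IsCentral c i} : ℝ) * ((Fintype.card (Idx P) : ℝ))⁻¹ ≤ 24 / 25) :
    ∀ (c : PBond P (j + 1)) (U : GaugeField P j (Matrix.specialUnitaryGroup (Fin 2) ℂ)), (∃ g : (Matrix.specialUnitaryGroup (Fin 2) ℂ), Small (expMeanLogSU : LoopAverage (Matrix.specialUnitaryGroup (Fin 2) ℂ)) (update U (centralBond c) g) c) →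
      (HaarData.haar : Measure (Matrix.specialUnitaryGroup (Fin 2) ℂ)).map (fun g => avgFun (expMeanLogSU : LoopAverage (Matrix.specialUnitaryGroup (Fin 2) ℂ)) (update U (centralBond c) g) c) ≤
        ((ENNReal.ofReal (((1 / 25 : ℝ) * Real.sin 1 * (Real.sin (Real.pi / 3) / (Real.pi / 3))) ^ 3 * (Real.sin (Real.pi / 3) / (Real.pi / 3)) ^ 2))⁻¹ + 1) •
          (HaarData.haar : Measure (Matrix.specialUnitaryGroup (Fin 2) ℂ)) :=
  fibre_law_le_of_core (expMeanLogSU : LoopAverage (Matrix.specialUnitaryGroup (Fin 2) ℂ)) hj measurable_expMeanLogSU_E fun c V hV => by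
    rw [haarData_haar_eq]; exact core_law_le_su2_wide_unif c V hV (hs c)

/-- ★★ **PART 20's ONE-STEP EXTENSIVE TRANSPORT BOUND AT THE [B10] SLOT, `N = 2`, (H_K) DISCHARGED, WIDE RANGE**:
`h(δ′)^n • (avOfPrint)_*(dU) ≤ (h(δ′) + (K − 1)·h(1∕3 + δ′)^{L^{d−1}−1})^n • dV`, `n = #PBond(j+1)`, `K = m⋆⋆⁻¹ + 1`, on `∀ c, #non-central(c)∕|Idx| ≤ 24∕25`
(part 11's count: `L^{d−1} ≤ 25`) — part 24's `smul_map_avOfPrint_le_of_core` at `N = 2` fed with §3.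
HONEST: one RG step; the k-uniform `hmass` of n08-w1's target is NOT supplied (stacking); the YM mass gap is NOT proved.
[cite: Balaban1985UV3, (2) p.256; Balaban1987RG1, (0.4) p.253 (bookkeeping — the bound is NOT in print)] -/
theorem smul_map_avOfPrint_le_su2_wide {L : ℕ} (S₀ : Scales L) {j : ℕ} (hj : j + 1 ≤ S₀.P.m + S₀.P.K)
    (hs : ∀ c : PBond S₀.P (j + 1), (Fintype.card {i : Idx S₀.P // ¬ IsCentral c i} : ℝ) * ((Fintype.card (Idx S₀.P) : ℝ))⁻¹ ≤ 24 / 25)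
    (δ' : ℝ) :
    (HaarData.haar : Measure (Matrix.specialUnitaryGroup (Fin 2) ℂ)) {g : (Matrix.specialUnitaryGroup (Fin 2) ℂ) | dist1 g < δ'} ^ Fintype.card (PBond S₀.P (j + 1)) •
        (fieldMeasure S₀.P j (Matrix.specialUnitaryGroup (Fin 2) ℂ)).map (avOfPrint 2 S₀ j).avg ≤
      ((HaarData.haar : Measure (Matrix.specialUnitaryGroup (Fin 2) ℂ)) {g : (Matrix.specialUnitaryGroup (Fin 2) ℂ) | dist1 g < δ'} +
          (((ENNReal.ofReal (((1 / 25 : ℝ) * Real.sin 1 * (Real.sin (Real.pi / 3) / (Real.pi / 3))) ^ 3 *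
              (Real.sin (Real.pi / 3) / (Real.pi / 3)) ^ 2))⁻¹ + 1) - 1) *
            (HaarData.haar : Measure (Matrix.specialUnitaryGroup (Fin 2) ℂ)) {g : (Matrix.specialUnitaryGroup (Fin 2) ℂ) | dist1 g < min (1 / 3) (Real.pi / (2 : ℕ)) + δ'} ^ (S₀.P.L ^ (S₀.P.d - 1) - 1)) ^
          Fintype.card (PBond S₀.P (j + 1)) •
        fieldMeasure S₀.P (j + 1) (Matrix.specialUnitaryGroup (Fin 2) ℂ) :=
  smul_map_avOfPrint_le_of_core 2 S₀ hj le_add_self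
    (ENNReal.add_ne_top.2 ⟨ENNReal.inv_ne_top.2 (ENNReal.ofReal_pos.2 mstar_wide_pos).ne', ENNReal.one_ne_top⟩) (fun c V hV => by
    rw [haarData_haar_eq]; exact core_law_le_su2_wide_unif c V hV (hs c)) δ'

/-! ## §4 The range in the record's letters: `#non-central∕|Idx| = 1 − L^{1−d}`, so `L^{d−1} ≤ 25` suffices (`L ∈ {3, 5}` at `d = 3`; the record's `8 ≤ θ.L` is NOT covered) -/

/-- By part 11's count `N_c·L^{d−1} = |Idx|`: `#non-central∕|Idx| = 1 − (L^{d−1})⁻¹`, hence `≤ 24∕25` as soon as `L^{d−1} ≤ 25`. [folklore] -/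
theorem card_not_central_div_le_wide (c : PBond P (j + 1)) (hL : P.L ^ (P.d - 1) ≤ 25) :
    (Fintype.card {i : Idx P // ¬ IsCentral c i} : ℝ) * ((Fintype.card (Idx P) : ℝ))⁻¹ ≤ 24 / 25 := by
  classical
  have hcard : (0 : ℝ) < Fintype.card (Idx P) := Nat.cast_pos.mpr Fintype.card_pos
  have hnc : (Fintype.card {i : Idx P // ¬ IsCentral c i} : ℝ) = Fintype.card (Idx P) - nCentral c := by
    have h1 : Fintype.card {i : Idx P // IsCentral c i} = nCentral c := by rw [nCentral, Fintype.card_subtype]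
    have h2 := Fintype.card_subtype_compl (IsCentral c)
    rw [h1] at h2
    have h3 : nCentral c ≤ Fintype.card (Idx P) := N08HaarCompatibilityGuardPowerMap.nCentral_le_card c
    rw [h2, Nat.cast_sub h3]
  have hlam : (nCentral c : ℝ) / (Fintype.card (Idx P) : ℝ) = ((P.L : ℝ) ^ (P.d - 1))⁻¹ := nCentral_div_card_real c
  have hLpos : (0 : ℝ) < (P.L : ℝ) ^ (P.d - 1) := by have := P.hL.2; positivity
  have h9 : (1 / 25 : ℝ) ≤ ((P.L : ℝ) ^ (P.d - 1))⁻¹ := by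
    rw [one_div]; exact inv_anti₀ hLpos (by exact_mod_cast hL)
  rw [hnc, sub_mul, mul_inv_cancel₀ hcard.ne', ← div_eq_mul_inv, hlam]
  linarith

/-- ★★★ **PART 20's BOUND AT THE SLOT, `N = 2`, `L^{d−1} ≤ 25` (block sizes `L ∈ {3, 5}` at `d = 3`; the record's `8 ≤ θ.L` is NOT covered — n08-w6 g5's every-L lane), NO (H_K) HYPOTHESIS.** [cite: Balaban1985UV3, (2) p.256;
Balaban1987RG1, (0.4) p.253 (bookkeeping — the bound is NOT in print)] -/
theorem smul_map_avOfPrint_le_su2_wide_of_pow_le {L : ℕ} (S₀ : Scales L) {j : ℕ} (hj : j + 1 ≤ S₀.P.m + S₀.P.K) (hL : S₀.P.L ^ (S₀.P.d - 1) ≤ 25) (δ' : ℝ) :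
    (HaarData.haar : Measure (Matrix.specialUnitaryGroup (Fin 2) ℂ)) {g : (Matrix.specialUnitaryGroup (Fin 2) ℂ) | dist1 g < δ'} ^ Fintype.card (PBond S₀.P (j + 1)) •
        (fieldMeasure S₀.P j (Matrix.specialUnitaryGroup (Fin 2) ℂ)).map (avOfPrint 2 S₀ j).avg ≤
      ((HaarData.haar : Measure (Matrix.specialUnitaryGroup (Fin 2) ℂ)) {g : (Matrix.specialUnitaryGroup (Fin 2) ℂ) | dist1 g < δ'} +
          (((ENNReal.ofReal (((1 / 25 : ℝ) * Real.sin 1 * (Real.sin (Real.pi / 3) / (Real.pi / 3))) ^ 3 *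
              (Real.sin (Real.pi / 3) / (Real.pi / 3)) ^ 2))⁻¹ + 1) - 1) *
            (HaarData.haar : Measure (Matrix.specialUnitaryGroup (Fin 2) ℂ)) {g : (Matrix.specialUnitaryGroup (Fin 2) ℂ) | dist1 g < min (1 / 3) (Real.pi / (2 : ℕ)) + δ'} ^ (S₀.P.L ^ (S₀.P.d - 1) - 1)) ^
          Fintype.card (PBond S₀.P (j + 1)) •
        fieldMeasure S₀.P (j + 1) (Matrix.specialUnitaryGroup (Fin 2) ℂ) :=
  smul_map_avOfPrint_le_su2_wide S₀ hj (fun c => card_not_central_div_le_wide c hL) δ'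

end Summit.QuantumFields.YangMills.BalabanUVNodes.N08HaarCompatibilityGuardCoreLawSU2Wide

end
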